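import Summits.AtomisticToContinuum.FouriersLaw.Theorems.BondHeatUncertaintyBoundedResponseBathHeatHorizonReturn
import HarnessLib


/-!
# BondHeatUncertainty / BoundedResponse — «LogWindow» §8–§9: WIDTH DOUBLING and the GAUSSIAN CONFINEMENT LEMMA for the thermal crossing defect
(decomp-a2c lens-1, g113, NODE 113 «LogWindow / MixingDoor»; part 1 of 4 — the overview, tags, barriers and failure modes are in the main file
`…BathHeatLogWindow`, which imports this chain A → B → C → main; the chain imports only the tree (NODE 112 `…BathHeatHorizonReturn`))

§8 width doubling `φ_T(x)·e^{x²/(4T)} = √2·φ_{2T}(x)` (`gaussianPDFReal_mul_exp_sq_div`), hence `f·e^{k²/(4T)} ∈ L¹(ν_T)` for `f ∈ L¹(ν_{2T})` and the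
exponential moments `(k²−T)²e^{k²/(4T)}, (k²+T)e^{k²/(4T)} ∈ L¹(ν_T)`.
§9 ★★ the GAUSSIAN CONFINEMENT LEMMA `thermalCrossDefect_le_of_monotoneSqOn_exp`: if `g ∈ L²(ν_T)` is nondecreasing in `k²` on `k² ≤ κ²` (`κ² ≥ 4T`)
then NODE 111's crossing defect obeys `𝔇_T(g) ≤ A_T·e^{−κ²/(8T)}·(1 + ∫ g² dν_T)` — NODE 112's comparison curve with the outer cost paid through the weight
`e^{κ²/(8T)}` in the weighted AM–GM (NODE 112: `(κ²)^{−j}`); packaging `thermalCrossDefect_le_of_confined_exp`: a budget `∫g² ≤ B·P` is cancelled by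
ANY window `W` with `P·e^{−W/(8T)} ≤ 1`, i.e. `W = 8T·log P`. Pure 1-D; no chain. No `sorry`, no new axioms.
-/

noncomputable section

open MeasureTheory ProbabilityTheory Filter Topology Set Function
open scoped NNReal ENNReal
open Literature.MathematicalPhysics.KineticTheory.HeatConduction
open Literature.MathematicalPhysics.KineticTheory OscillatorChain
open Literature.Probability.Process
open Summit.AtomisticToContinuum.FouriersLaw.Theorems.SubdiffusiveBondHeat (boundaryKernelBasics_proof)

namespace Summit.AtomisticToContinuum.FouriersLaw.Theorems.BoundedResponse.HeatSpreading

/-! ## §8 (NODE 113) Width doubling `ν_T ↦ ν_{2T}` and the exponential moments behind the GAUSSIAN confinement lemma -/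

section GaussExp

/-- **Width doubling**: `φ_T(x)·e^{x²/(4T)} = √2·φ_{2T}(x)` (`T > 0`) — the thermal Gaussian density times the confinement weight
`e^{x²/(4T)}` is `√2` times the Gaussian density of DOUBLE temperature. [folklore] -/
theorem gaussianPDFReal_mul_exp_sq_div {T : ℝ} (hT : 0 < T) (x : ℝ) :
    gaussianPDFReal 0 T.toNNReal x * Real.exp (x ^ 2 / (4 * T)) = Real.sqrt 2 * gaussianPDFReal 0 (2 * T).toNNReal x := by
  have hT0 : T ≠ 0 := hT.ne'
  have h2T : (0 : ℝ) ≤ 2 * T := by positivity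
  simp only [gaussianPDFReal, Real.coe_toNNReal _ hT.le, Real.coe_toNNReal _ h2T, sub_zero]
  have hsq : Real.sqrt (2 * Real.pi * (2 * T)) = Real.sqrt 2 * Real.sqrt (2 * Real.pi * T) := by
    rw [show 2 * Real.pi * (2 * T) = 2 * (2 * Real.pi * T) by ring, Real.sqrt_mul (by norm_num : (0 : ℝ) ≤ 2)]
  have hs2 : Real.sqrt 2 ≠ 0 := (Real.sqrt_pos.2 (by norm_num : (0 : ℝ) < 2)).ne'
  have hsπ : Real.sqrt (2 * Real.pi * T) ≠ 0 := (Real.sqrt_pos.2 (by positivity : (0 : ℝ) < 2 * Real.pi * T)).ne'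
  have hexp : Real.exp (-x ^ 2 / (2 * T)) * Real.exp (x ^ 2 / (4 * T)) = Real.exp (-x ^ 2 / (2 * (2 * T))) := by
    rw [← Real.exp_add]
    congr 1
    field_simp
    ring
  rw [mul_assoc, hexp, hsq, mul_inv]
  have h1 : Real.sqrt 2 * (Real.sqrt 2)⁻¹ = 1 := mul_inv_cancel₀ hs2
  generalize Real.exp (-x ^ 2 / (2 * (2 * T))) = E
  linear_combination (-((Real.sqrt (2 * Real.pi * T))⁻¹ * E)) * h1

/-- **Width doubling, integrability form**: `f·e^{k²/(4T)} ∈ L¹(ν_T)` whenever `f ∈ L¹(ν_{2T})` (`T > 0`). [folklore] -/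
theorem gaussT_integrable_mul_expSq {T : ℝ} (hT : 0 < T) {f : ℝ → ℝ} (hf : Integrable f (gaussianReal 0 (2 * T).toNNReal)) :
    Integrable (fun k => f k * Real.exp (k ^ 2 / (4 * T))) (gaussianReal 0 T.toNNReal) := by
  have hv : T.toNNReal ≠ 0 := by
    rw [Ne, Real.toNNReal_eq_zero, not_le]; exact hT
  have hv2 : (2 * T).toNNReal ≠ 0 := by
    rw [Ne, Real.toNNReal_eq_zero, not_le]; positivity
  rw [gaussianReal_of_var_ne_zero 0 hv2, integrable_withDensity_iff_integrable_smul' (measurable_gaussianPDF 0 _)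
    (ae_of_all _ fun _ => gaussianPDF_lt_top)] at hf
  rw [gaussianReal_of_var_ne_zero 0 hv, integrable_withDensity_iff_integrable_smul' (measurable_gaussianPDF 0 _)
    (ae_of_all _ fun _ => gaussianPDF_lt_top)]
  simp only [toReal_gaussianPDF, smul_eq_mul] at hf ⊢
  have e : (fun x => gaussianPDFReal 0 T.toNNReal x * (f x * Real.exp (x ^ 2 / (4 * T)))) =
      fun x => Real.sqrt 2 * (gaussianPDFReal 0 (2 * T).toNNReal x * f x) := by
    funext x
    calc gaussianPDFReal 0 T.toNNReal x * (f x * Real.exp (x ^ 2 / (4 * T)))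
        = (gaussianPDFReal 0 T.toNNReal x * Real.exp (x ^ 2 / (4 * T))) * f x := by ring
      _ = Real.sqrt 2 * (gaussianPDFReal 0 (2 * T).toNNReal x * f x) := by
          rw [gaussianPDFReal_mul_exp_sq_div hT x]; ring
  rw [e]
  exact hf.const_mul _

/-- The exponential moments of the Gaussian confinement lemma: `(k²−T)²·e^{k²/(4T)}` and `(k²+T)·e^{k²/(4T)}` are `ν_T`-integrable
(`T > 0`; width doubling + polynomial moments of `ν_{2T}`, tree `lightCone_integrable_pow_gaussianReal`). [folklore] -/
theorem gaussT_integrable_expMoments {T : ℝ} (hT : 0 < T) :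
    Integrable (fun k : ℝ => (k ^ 2 - T) ^ 2 * Real.exp (k ^ 2 / (4 * T))) (gaussianReal 0 T.toNNReal) ∧
      Integrable (fun k : ℝ => (k ^ 2 + T) * Real.exp (k ^ 2 / (4 * T))) (gaussianReal 0 T.toNNReal) := by
  have hp := PhononMeanFreePath.lightCone_integrable_pow_gaussianReal (2 * T)
  refine ⟨gaussT_integrable_mul_expSq hT ?_, gaussT_integrable_mul_expSq hT ?_⟩
  · have e : (fun k : ℝ => (k ^ 2 - T) ^ 2) = fun k => (k ^ 4 - 2 * T * k ^ 2) + T ^ 2 * k ^ 0 := by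
      funext k; ring
    rw [e]
    exact ((hp 4).sub ((hp 2).const_mul _)).add ((hp 0).const_mul _)
  · have e : (fun k : ℝ => k ^ 2 + T) = fun k => k ^ 2 + T * k ^ 0 := by
      funext k; ring
    rw [e]
    exact (hp 2).add ((hp 0).const_mul _)

end GaussExp

/-! ## §9 (NODE 113) The GAUSSIAN CONFINEMENT LEMMA: the hard-kick region costs `e^{−κ²/(8T)}`, not `(κ²)^{−j}` -/

section GaussConfine

/-- Outer pointwise estimate with EXPONENTIAL weights: for `0 ≤ K ≤ x`, `|θ| ≤ x + T`, `|A| ≤ aB`, `T > 0`,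
`|θ|·|G − A| ≤ e^{−K/(8T)}·(θ²·e^{x/(4T)}/2 + G²/2 + aB·(x+T)·e^{x/(4T)})` (weighted AM–GM with weight `e^{K/(8T)}`). [this cell] -/
theorem outer_pointwise_bound_exp {K x θ G A aB T : ℝ} (hT : 0 < T) (hK : 0 ≤ K) (hKx : K ≤ x) (hθ : |θ| ≤ x + T)
    (hA : |A| ≤ aB) :
    |θ| * |G - A| ≤ Real.exp (-(K / (8 * T))) *
      (θ ^ 2 * Real.exp (x / (4 * T)) / 2 + G ^ 2 / 2 + aB * ((x + T) * Real.exp (x / (4 * T)))) := by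
  obtain ⟨L, hL⟩ : ∃ L : ℝ, L = Real.exp (K / (8 * T)) := ⟨_, rfl⟩
  have hL0 : 0 < L := by rw [hL]; exact Real.exp_pos _
  have hLne : L ≠ 0 := hL0.ne'
  have hEL : Real.exp (-(K / (8 * T))) = L⁻¹ := by rw [hL, Real.exp_neg]
  have hx : 0 ≤ x := hK.trans hKx
  have hxT : 0 ≤ x + T := (abs_nonneg θ).trans hθ
  have haB : 0 ≤ aB := (abs_nonneg A).trans hA
  have h8T : 0 < 8 * T := by positivity
  have hLL : L * L ≤ Real.exp (x / (4 * T)) := by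
    rw [hL, ← Real.exp_add, Real.exp_le_exp]
    have e : K / (8 * T) + K / (8 * T) = K / (4 * T) := by
      field_simp
      ring
    rw [e]
    exact div_le_div_of_nonneg_right hKx (by positivity)
  have hL1 : L ≤ Real.exp (x / (4 * T)) := by
    rw [hL, Real.exp_le_exp]
    calc K / (8 * T) ≤ x / (8 * T) := div_le_div_of_nonneg_right hKx h8T.le
      _ ≤ x / (4 * T) := div_le_div_of_nonneg_left hx (by positivity) (by linarith)
  -- weighted AM–GM for the `G`-term, the crude bound for the `A`-term
  have h1 : |θ| * |G| ≤ (L * θ ^ 2 + G ^ 2 / L) / 2 := abs_mul_abs_le_weighted hL0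
  have h2 : |θ| * |A| ≤ (x + T) * aB := mul_le_mul hθ hA (abs_nonneg _) hxT
  have i1 : θ ^ 2 * (L * L) ≤ θ ^ 2 * Real.exp (x / (4 * T)) := mul_le_mul_of_nonneg_left hLL (sq_nonneg θ)
  have i3 : aB * ((x + T) * L) ≤ aB * ((x + T) * Real.exp (x / (4 * T))) :=
    mul_le_mul_of_nonneg_left (mul_le_mul_of_nonneg_left hL1 hxT) haB
  have hLi : 0 ≤ L⁻¹ := inv_nonneg.2 hL0.le
  have halg : (L * θ ^ 2 + G ^ 2 / L) / 2 + (x + T) * aB = L⁻¹ * (θ ^ 2 * (L * L) / 2 + G ^ 2 / 2 + aB * ((x + T) * L)) := by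
    field_simp
  rw [hEL]
  calc |θ| * |G - A| ≤ |θ| * (|G| + |A|) := by gcongr; exact abs_sub _ _
    _ = |θ| * |G| + |θ| * |A| := by ring
    _ ≤ (L * θ ^ 2 + G ^ 2 / L) / 2 + (x + T) * aB := add_le_add h1 h2
    _ = L⁻¹ * (θ ^ 2 * (L * L) / 2 + G ^ 2 / 2 + aB * ((x + T) * L)) := halg
    _ ≤ L⁻¹ * (θ ^ 2 * Real.exp (x / (4 * T)) / 2 + G ^ 2 / 2 + aB * ((x + T) * Real.exp (x / (4 * T)))) := by
        refine mul_le_mul_of_nonneg_left ?_ hLi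
        linarith

/-- ★★ **THE GAUSSIAN CONFINEMENT LEMMA (NODE 113; sharpens NODE 112's polynomial one).**  For `T > 0` there is `A = A(T) ≥ 0` such that for
every confinement radius `κ` with `κ² ≥ 4T` and every `g ∈ L²(ν_T)` that is NONDECREASING IN `k²` ON `k² ≤ κ²` only,

  `𝔇_T(g) ≤ A · e^{−κ²/(8T)} · (1 + ‖g‖²_{L²(ν_T)})`.

Mechanism: NODE 112's comparison curve (`R = g` on `k² ≤ κ²`, `R ≡ g(√T)` outside; `thermalCrossDefect_le`, crossing level by
`abs_crossLevel_mul_window_le`), but the outer cost is now paid with the weight `e^{κ²/(8T)} ≤ e^{k²/(8T)}` inside the weighted AM–GM, whose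
moments `∫(k²∓T)^{2,1}e^{k²/(4T)}dν_T` are finite by WIDTH DOUBLING (`ν_T·e^{k²/(4T)} = √2·ν_{2T}`).  The gain is the Gaussian tail itself:
a budget `‖g‖² ≤ P` is neutralised by the radius `κ² = 8T·log P` — LOGARITHMIC, where NODE 112 needed `κ² = P^{1/j}`. [this cell; NEW] -/
theorem thermalCrossDefect_le_of_monotoneSqOn_exp {T : ℝ} (hT : 0 < T) :
    ∃ A : ℝ, 0 ≤ A ∧ ∀ (κ : ℝ) (g : ℝ → ℝ), 4 * T ≤ κ ^ 2 →
      AEStronglyMeasurable g (gaussianReal 0 T.toNNReal) →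
      Integrable (fun k => g k ^ 2) (gaussianReal 0 T.toNNReal) →
      (∀ k₁ k₂ : ℝ, k₁ ^ 2 ≤ k₂ ^ 2 → k₂ ^ 2 ≤ κ ^ 2 → g k₁ ≤ g k₂) →
      thermalCrossDefect T g ≤ A * Real.exp (-(κ ^ 2 / (8 * T))) * (1 + ∫ k, g k ^ 2 ∂(gaussianReal 0 T.toNNReal)) := by
  obtain ⟨hM1i, hM2i⟩ := gaussT_integrable_expMoments hT
  obtain ⟨M₁, hM1⟩ : ∃ M : ℝ, M = ∫ k, (k ^ 2 - T) ^ 2 * Real.exp (k ^ 2 / (4 * T)) ∂(gaussianReal 0 T.toNNReal) := ⟨_, rfl⟩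
  obtain ⟨M₂, hM2⟩ : ∃ M : ℝ, M = ∫ k, (k ^ 2 + T) * Real.exp (k ^ 2 / (4 * T)) ∂(gaussianReal 0 T.toNNReal) := ⟨_, rfl⟩
  have hM10 : 0 ≤ M₁ := hM1 ▸ integral_nonneg fun k => by positivity
  have hM20 : 0 ≤ M₂ := hM2 ▸ integral_nonneg fun k => by positivity
  have hsT2 : Real.sqrt T ^ 2 = T := Real.sq_sqrt hT.le
  have hp0 := gaussTWindow_pos hT
  obtain ⟨p, hp⟩ : ∃ p : ℝ, p = gaussTWindow T := ⟨_, rfl⟩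
  rw [← hp] at hp0
  refine ⟨M₁ / 2 + 1 / 2 + M₂ / (2 * p), by positivity, ?_⟩
  intro κ g hκ hgm hg2 hmono
  have hκ0 : 0 < κ ^ 2 := lt_of_lt_of_le (by positivity) hκ
  obtain ⟨I, hI⟩ : ∃ I : ℝ, I = ∫ k, g k ^ 2 ∂(gaussianReal 0 T.toNNReal) := ⟨_, rfl⟩
  have hI0 : 0 ≤ I := hI ▸ integral_nonneg fun k => sq_nonneg _
  obtain ⟨a, ha⟩ : ∃ a : ℝ, a = g (Real.sqrt T) := ⟨_, rfl⟩
  -- (1) the crossing level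
  obtain ⟨aB, haB⟩ : ∃ aB : ℝ, aB = (1 + I) / (2 * p) := ⟨_, rfl⟩
  have habs : |a| ≤ aB := by
    have h := abs_crossLevel_mul_window_le hT hκ hgm hg2 hmono
    rw [← hp, ← hI, ← ha] at h
    rw [haB, le_div_iff₀ (by positivity)]; linarith
  have haB0 : 0 ≤ aB := (abs_nonneg a).trans habs
  -- (2) the comparison curve
  obtain ⟨R, hR⟩ : ∃ R : ℝ → ℝ, R = fun k => if k ^ 2 ≤ κ ^ 2 then g k else a := ⟨_, rfl⟩
  have hSi : MeasurableSet {k : ℝ | k ^ 2 ≤ κ ^ 2} := measurableSet_le (measurable_id.pow_const 2) measurable_const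
  have hadm : ∀ k : ℝ, 0 ≤ (k ^ 2 - T) * (R k - (a + 0 * k)) := by
    intro k
    rw [hR]; simp only [zero_mul, add_zero]
    split_ifs with hk
    · rcases le_or_gt T (k ^ 2) with hTk | hTk
      · have : a ≤ g k := ha ▸ hmono _ _ (by rw [hsT2]; exact hTk) hk
        exact mul_nonneg (by linarith) (by linarith)
      · have : g k ≤ a := ha ▸ hmono _ _ (by rw [hsT2]; exact hTk.le) (by rw [hsT2]; linarith)
        exact mul_nonneg_of_nonpos_of_nonpos (by linarith) (by linarith)
    · simp
  have hθ2 : Integrable (fun k : ℝ => (k ^ 2 - T) ^ 2) (gaussianReal 0 T.toNNReal) := by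
    have hp' := PhononMeanFreePath.lightCone_integrable_pow_gaussianReal T
    have e : (fun k : ℝ => (k ^ 2 - T) ^ 2) = fun k => (k ^ 4 - 2 * T * k ^ 2) + T ^ 2 * k ^ 0 := by
      funext k; ring
    rw [e]
    exact ((hp' 4).sub ((hp' 2).const_mul _)).add ((hp' 0).const_mul _)
  have hθm : AEStronglyMeasurable (fun k : ℝ => k ^ 2 - T) (gaussianReal 0 T.toNNReal) := by fun_prop
  have hθg : Integrable (fun k : ℝ => (k ^ 2 - T) * g k) (gaussianReal 0 T.toNNReal) :=
    integrable_mul_of_sq_sq hθm hgm hθ2 hg2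
  have hθa : Integrable (fun k : ℝ => a * (k ^ 2 - T)) (gaussianReal 0 T.toNNReal) :=
    (gaussT_integrable_sqSub T).const_mul a
  have hRint : Integrable (fun k => (k ^ 2 - T) * R k) (gaussianReal 0 T.toNNReal) := by
    have h := (hθg.indicator hSi).add (hθa.indicator hSi.compl)
    refine h.congr (Eventually.of_forall fun k => ?_)
    rw [hR]; simp only [Pi.add_apply, indicator, mem_setOf_eq, mem_compl_iff]
    split_ifs <;> ring
  have hD := thermalCrossDefect_le (g := g) hadm hRint
  -- (3) the pointwise outer bound, exponential weights
  obtain ⟨Φ, hΦ⟩ : ∃ Φ : ℝ → ℝ, Φ = fun k => Real.exp (-(κ ^ 2 / (8 * T))) *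
      (((k ^ 2 - T) ^ 2 * Real.exp (k ^ 2 / (4 * T))) / 2 + g k ^ 2 / 2 + aB * ((k ^ 2 + T) * Real.exp (k ^ 2 / (4 * T)))) :=
    ⟨_, rfl⟩
  have hΦi : Integrable Φ (gaussianReal 0 T.toNNReal) := by
    rw [hΦ]; exact (((hM1i.div_const 2).add (hg2.div_const 2)).add (hM2i.const_mul aB)).const_mul _
  have hpt : ∀ k, |k ^ 2 - T| * |g k - R k| ≤ Φ k := by
    intro k
    by_cases hk : k ^ 2 ≤ κ ^ 2
    · have hRk : R k = g k := by rw [hR]; exact if_pos hk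
      have hΦ0 : 0 ≤ Φ k := by rw [hΦ]; positivity
      rw [hRk, sub_self, abs_zero, mul_zero]; exact hΦ0
    · have hRk : R k = a := by rw [hR]; exact if_neg hk
      have hθ : |k ^ 2 - T| ≤ k ^ 2 + T := by
        rw [abs_le]; constructor <;> nlinarith [sq_nonneg k, hT]
      rw [hRk, hΦ]
      exact outer_pointwise_bound_exp hT hκ0.le (not_le.1 hk).le hθ habs
  -- (4) integrate
  have hint : ∫ k, |k ^ 2 - T| * |g k - R k| ∂(gaussianReal 0 T.toNNReal) ≤ ∫ k, Φ k ∂(gaussianReal 0 T.toNNReal) :=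
    integral_mono_of_nonneg (Eventually.of_forall fun k => by positivity) hΦi (Eventually.of_forall hpt)
  have hΦv : ∫ k, Φ k ∂(gaussianReal 0 T.toNNReal) = Real.exp (-(κ ^ 2 / (8 * T))) * (M₁ / 2 + I / 2 + aB * M₂) := by
    have i3 : Integrable (fun k : ℝ => (k ^ 2 - T) ^ 2 * Real.exp (k ^ 2 / (4 * T)) / 2) (gaussianReal 0 T.toNNReal) :=
      hM1i.div_const 2
    have i4 : Integrable (fun k : ℝ => g k ^ 2 / 2) (gaussianReal 0 T.toNNReal) := hg2.div_const 2
    have i1 : Integrable (fun k : ℝ => (k ^ 2 - T) ^ 2 * Real.exp (k ^ 2 / (4 * T)) / 2 + g k ^ 2 / 2)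
        (gaussianReal 0 T.toNNReal) := i3.add i4
    have i2 : Integrable (fun k : ℝ => aB * ((k ^ 2 + T) * Real.exp (k ^ 2 / (4 * T)))) (gaussianReal 0 T.toNNReal) :=
      hM2i.const_mul aB
    rw [hΦ, integral_const_mul, integral_add i1 i2, integral_add i3 i4, integral_div, integral_div, integral_const_mul,
      ← hM1, ← hM2, ← hI]
  have hfin : Real.exp (-(κ ^ 2 / (8 * T))) * (M₁ / 2 + I / 2 + aB * M₂) ≤
      (M₁ / 2 + 1 / 2 + M₂ / (2 * p)) * Real.exp (-(κ ^ 2 / (8 * T))) * (1 + I) := by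
    have hρj : 0 ≤ Real.exp (-(κ ^ 2 / (8 * T))) := (Real.exp_pos _).le
    have h1 : M₁ / 2 + I / 2 + aB * M₂ ≤ (M₁ / 2 + 1 / 2 + M₂ / (2 * p)) * (1 + I) := by
      rw [haB]
      have e : (1 + I) / (2 * p) * M₂ = M₂ / (2 * p) * (1 + I) := by ring
      rw [e]
      nlinarith [mul_nonneg hI0 hM10, div_nonneg hM20 (by positivity : (0:ℝ) ≤ 2 * p)]
    calc Real.exp (-(κ ^ 2 / (8 * T))) * (M₁ / 2 + I / 2 + aB * M₂)
        ≤ Real.exp (-(κ ^ 2 / (8 * T))) * ((M₁ / 2 + 1 / 2 + M₂ / (2 * p)) * (1 + I)) := mul_le_mul_of_nonneg_left h1 hρj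
      _ = _ := by ring
  calc thermalCrossDefect T g ≤ ∫ k, |k ^ 2 - T| * |g k - R k| ∂(gaussianReal 0 T.toNNReal) := hD
    _ ≤ ∫ k, Φ k ∂(gaussianReal 0 T.toNNReal) := hint
    _ = Real.exp (-(κ ^ 2 / (8 * T))) * (M₁ / 2 + I / 2 + aB * M₂) := hΦv
    _ ≤ (M₁ / 2 + 1 / 2 + M₂ / (2 * p)) * Real.exp (-(κ ^ 2 / (8 * T))) * (1 + I) := hfin
    _ = (M₁ / 2 + 1 / 2 + M₂ / (2 * p)) * Real.exp (-(κ ^ 2 / (8 * T))) * (1 + ∫ k, g k ^ 2 ∂(gaussianReal 0 T.toNNReal)) := by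
        rw [hI]

variable {T : ℝ}

/-- **Packaging the Gaussian confinement lemma for the doors**: `g =ᵐ R`, `R` nondecreasing in `k²` on `k² ≤ W` (`W ≥ 4T`), `∫g² ≤ B·P`
with `1 ≤ P` and `P·e^{−W/(8T)} ≤ 1` ⟹ `𝔇_T(g) ≤ A_T·(1 + B)`: ANY budget `P` is cancelled by the window `W = 8T·log P`. [this cell] -/
theorem thermalCrossDefect_le_of_confined_exp (hT : 0 < T) {A : ℝ} (hA0 : 0 ≤ A)
    (hA : ∀ (κ : ℝ) (g : ℝ → ℝ), 4 * T ≤ κ ^ 2 → AEStronglyMeasurable g (gaussianReal 0 T.toNNReal) →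
      Integrable (fun k => g k ^ 2) (gaussianReal 0 T.toNNReal) →
      (∀ k₁ k₂ : ℝ, k₁ ^ 2 ≤ k₂ ^ 2 → k₂ ^ 2 ≤ κ ^ 2 → g k₁ ≤ g k₂) →
      thermalCrossDefect T g ≤ A * Real.exp (-(κ ^ 2 / (8 * T))) * (1 + ∫ k, g k ^ 2 ∂(gaussianReal 0 T.toNNReal)))
    {g R : ℝ → ℝ} {W B P : ℝ} (hW : 4 * T ≤ W) (hgm : AEStronglyMeasurable g (gaussianReal 0 T.toNNReal))
    (hg2 : Integrable (fun k => g k ^ 2) (gaussianReal 0 T.toNNReal))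
    (hgB : ∫ k, g k ^ 2 ∂(gaussianReal 0 T.toNNReal) ≤ B * P) (hB : 0 ≤ B) (hP1 : 1 ≤ P)
    (hPW : P * Real.exp (-(W / (8 * T))) ≤ 1)
    (hRmono : ∀ k₁ k₂ : ℝ, k₁ ^ 2 ≤ k₂ ^ 2 → k₂ ^ 2 ≤ W → R k₁ ≤ R k₂) (hRae : g =ᵐ[gaussianReal 0 T.toNNReal] R) :
    thermalCrossDefect T g ≤ A * (1 + B) := by
  have hW0 : 0 ≤ W := le_trans (by positivity) hW
  rw [thermalCrossDefect_congr_ae hRae]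
  have hRm : AEStronglyMeasurable R (gaussianReal 0 T.toNNReal) := hgm.congr hRae
  have hR2ae : (fun k => g k ^ 2) =ᵐ[gaussianReal 0 T.toNNReal] fun k => R k ^ 2 := by
    filter_upwards [hRae] with k hk
    rw [hk]
  have hR2 : Integrable (fun k => R k ^ 2) (gaussianReal 0 T.toNNReal) := hg2.congr hR2ae
  have hR2le : ∫ k, R k ^ 2 ∂(gaussianReal 0 T.toNNReal) ≤ B * P := by rw [← integral_congr_ae hR2ae]; exact hgB
  have hκ : 4 * T ≤ Real.sqrt W ^ 2 := by rw [Real.sq_sqrt hW0]; exact hW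
  have hmono' : ∀ k₁ k₂ : ℝ, k₁ ^ 2 ≤ k₂ ^ 2 → k₂ ^ 2 ≤ Real.sqrt W ^ 2 → R k₁ ≤ R k₂ := by
    intro k₁ k₂ h12 h2
    rw [Real.sq_sqrt hW0] at h2
    exact hRmono k₁ k₂ h12 h2
  have hconf := hA (Real.sqrt W) R hκ hRm hR2 hmono'
  rw [Real.sq_sqrt hW0] at hconf
  have hE0 : 0 ≤ Real.exp (-(W / (8 * T))) := (Real.exp_pos _).le
  have h1 : 1 + ∫ k, R k ^ 2 ∂(gaussianReal 0 T.toNNReal) ≤ (1 + B) * P := by nlinarith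
  calc thermalCrossDefect T R ≤ A * Real.exp (-(W / (8 * T))) * (1 + ∫ k, R k ^ 2 ∂(gaussianReal 0 T.toNNReal)) := hconf
    _ ≤ A * Real.exp (-(W / (8 * T))) * ((1 + B) * P) := mul_le_mul_of_nonneg_left h1 (mul_nonneg hA0 hE0)
    _ = A * (1 + B) * (P * Real.exp (-(W / (8 * T)))) := by ring
    _ ≤ A * (1 + B) * 1 := mul_le_mul_of_nonneg_left hPW (by positivity)
    _ = A * (1 + B) := mul_one _

end GaussConfine

end Summit.AtomisticToContinuum.FouriersLaw.Theorems.BoundedResponse.HeatSpreading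

end
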